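import Summits.CriticalPhenomena.PercolationContinuityZ3.Theses.PercNonProliferation
import Summits.CriticalPhenomena.PercolationContinuityZ3.Theses.PercDebrisSweep
import Literature.Probability.Percolation.InfiniteClusterDensity
import Literature.Probability.Percolation.ConnectivityProofs
import Literature.Probability.Percolation.BondPercolationSymmetry
import Literature.Probability.Percolation.SharpnessDCTProofs
import Literature.Probability.Percolation.PercolationProofs
import HarnessLib

/-!
# Crux `PercNonProliferation.NonProliferation` (stmt-CriticalPhenomena-4444), line `jump-fragmentation` —
# stub `stub_jumpFiniteDebrisTight` (S2, the finite spanning debris of a jump world) is implied by the crux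
# `PercDebrisSweep.FiniteClusterVolumeTail` (stmt-CriticalPhenomena-0943), with `M = 0`

Line `jump-fragmentation` (skeleton `Cruxes/NonProliferation/Lines/jump_fragmentation.lean`, lead c8) re-cuts the
crux along INFINITE (S1) / FINITE (S2) / CONTINUOUS (S3). S2 = `stub_jumpFiniteDebrisTight`: if
`θ(p_c(ℤ³)) > 0` then for every `ε > 0` there is `M` such that for all large `n`, with probability `≤ ε` there are
`M + 1` NON-percolating points of `B(n)`, each joined inside `B(2n)` to `∂ⁱⁿB(2n)`, pairwise not joined inside
`B(2n)`. Standalone this is a Kesten–Zhang-type statement at a hypothetical percolating `p_c` (nothing in print).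

What this file records (lands `--supports stmt-CriticalPhenomena-4444`; **closes nothing by itself**): S2 follows,
already with `M = 0`, from the open crux `FiniteClusterVolumeTail` of route `PercDebrisSweep`
(stmt-CriticalPhenomena-0943: for every `p` with `θ(p) > 0` there is `c > 0` with
`P_p(m ≤ |C(0)| < ∞) ≤ exp(-c m^{2/3})` for all `m ≥ 1`), applied at `p = p_c(ℤ³)`:

* a non-percolating `x ∈ B(n)` joined inside `B(2n)` to `y ∈ ∂ⁱⁿB(2n)` (on a lattice configuration, which is
  almost sure) has `n + 1 ≤ |C(x)| < ∞`: some coordinate has `|yᵢ| = 2n ≥ |xᵢ| + n`, and an open lattice walk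
  `x → y` forces `|C(x)| ≥ |yᵢ - xᵢ| + 1` (`le_encard_openCluster_of_walk`);
* translation invariance (`bondPercolation_real_preimage_shift`, `openCluster_relabel_shift`) moves `x` to the
  origin, the union bound over the `(2n+1)³` points of `B(n)` and `FiniteClusterVolumeTail` with `m = n + 1`
  give `P ≤ (2n+1)³ exp(-c (n+1)^{2/3}) ≤ (5760 / c⁶) / (n + 1) → 0` (`x⁶/6! ≤ eˣ`).
-/

noncomputable section

namespace Summit.CriticalPhenomena.PercolationContinuityZ3.Theorems.NonProliferation

open MeasureTheory Filter Topology
open Literature.Probability.LatticeModels Literature.Probability.Percolation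

namespace JumpFiniteDebris

/-- An edge of the open graph of `ω` is an open edge (an element of `ω`). -/
theorem mem_of_mem_edgeSet_openGraph {V : Type*} {ω : BondConfig V} {e : Sym2 V}
    (he : e ∈ (openGraph ω).edgeSet) : e ∈ ω := by
  induction e using Sym2.ind with
  | h a b =>
    rw [SimpleGraph.mem_edgeSet, openGraph_adj] at he
    exact he.1

/-- On a lattice configuration, `{x ↔ y in S}` is witnessed by a lattice walk with open edges. -/
theorem exists_latticeWalk_of_mem_openConnIn {d : ℕ} {ω : BondConfig (Site d)}
    (hω : ω ⊆ (zdGraph d).edgeSet) {S : Set (Site d)} {x y : Site d} (h : ω ∈ openConnIn S x y) :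
    ∃ W : (zdGraph d).Walk x y, ∀ e ∈ W.edges, e ∈ ω := by
  obtain ⟨hx, hy, ⟨q⟩⟩ := h
  let W₀ : (openGraph ω).Walk x y := (q.map (SimpleGraph.Embedding.induce S).toHom).copy rfl rfl
  have hW₀ : ∀ e ∈ W₀.edges, e ∈ ω := fun e he =>
    mem_of_mem_edgeSet_openGraph (W₀.edges_subset_edgeSet he)
  refine ⟨W₀.transfer (zdGraph d) (fun e he => hω (hW₀ e he)), fun e he => ?_⟩
  rw [SimpleGraph.Walk.edges_transfer] at he
  exact hW₀ e he

/-- **A spanning point has a large cluster.** On a lattice configuration, a point `x ∈ B(n)` joined inside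
`B(2n)` to a vertex `y` of `∂ⁱⁿB(2n)` has `|C(x)| ≥ n + 1`: some coordinate of `y` has modulus `2n`, the same
coordinate of `x` has modulus `≤ n`, and an open lattice walk `x → y` gives `|C(x)| ≥ |yᵢ - xᵢ| + 1`. -/
theorem succ_le_encard_openCluster {d n : ℕ} {ω : BondConfig (Site d)} (hω : ω ⊆ (zdGraph d).edgeSet)
    {x y : Site d} (hx : x ∈ box d n) (hy : y ∈ innerBoundary (zdGraph d) (box d (2 * n)))
    (h : ω ∈ openConnIn (↑(box d (2 * n)) : Set (Site d)) x y) :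
    ((n + 1 : ℕ) : ℕ∞) ≤ (openCluster ω x).encard := by
  obtain ⟨W, hW⟩ := exists_latticeWalk_of_mem_openConnIn hω h
  obtain ⟨i, hi⟩ := DCT16.exists_natAbs_eq_of_mem_innerBoundary_box hy
  refine le_trans ?_ (le_encard_openCluster_of_walk W hW i)
  have hxi := (mem_box.1 hx) i
  have : n + 1 ≤ (y i - x i).natAbs + 1 := by omega
  exact_mod_cast this

/-- **Exponential beats polynomial**: `(2n+1)³ · exp(-c (n+1)^{2/3}) ≤ (5760 / c⁶) · 1/(n+1)` for `c > 0`
(`x⁶/6! ≤ eˣ` with `x = c (n+1)^{2/3}`, `x⁶ = c⁶ (n+1)⁴`, and `(2n+1)³ ≤ 8 (n+1)³`). -/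
theorem cube_mul_exp_le {c : ℝ} (hc : 0 < c) (n : ℕ) :
    (((2 * n + 1) ^ 3 : ℕ) : ℝ) * Real.exp (-(c * ((n + 1 : ℕ) : ℝ) ^ ((2 : ℝ) / 3))) ≤
      5760 / c ^ 6 * (1 / ((n : ℝ) + 1)) := by
  set m : ℝ := ((n + 1 : ℕ) : ℝ) with hm
  have hm' : m = (n : ℝ) + 1 := by rw [hm]; push_cast; ring
  have hm1 : (1 : ℝ) ≤ m := by rw [hm']; linarith [(Nat.cast_nonneg n : (0 : ℝ) ≤ n)]
  have hm0 : 0 < m := by linarith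
  have hc0 : c ≠ 0 := hc.ne'
  have hmne : m ≠ 0 := hm0.ne'
  have hx0 : 0 ≤ c * m ^ ((2 : ℝ) / 3) := by positivity
  have hxpow : (c * m ^ ((2 : ℝ) / 3)) ^ 6 = c ^ 6 * m ^ 4 := by
    rw [mul_pow, ← Real.rpow_mul_natCast hm0.le]
    congr 1
    rw [show (2 : ℝ) / 3 * ((6 : ℕ) : ℝ) = ((4 : ℕ) : ℝ) by push_cast; ring]
    exact Real.rpow_natCast _ _
  have hexp : Real.exp (-(c * m ^ ((2 : ℝ) / 3))) ≤ 720 / (c ^ 6 * m ^ 4) := by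
    have h1 := Real.pow_div_factorial_le_exp _ hx0 6
    rw [hxpow, show ((Nat.factorial 6 : ℕ) : ℝ) = 720 by norm_num [Nat.factorial]] at h1
    rw [Real.exp_neg]
    have hpos : 0 < c ^ 6 * m ^ 4 / 720 := by positivity
    calc (Real.exp (c * m ^ ((2 : ℝ) / 3)))⁻¹ ≤ (c ^ 6 * m ^ 4 / 720)⁻¹ := inv_anti₀ hpos h1
      _ = 720 / (c ^ 6 * m ^ 4) := by rw [inv_div]
  have hpoly : (((2 * n + 1) ^ 3 : ℕ) : ℝ) ≤ 8 * m ^ 3 := by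
    have h2 : (2 * (n : ℝ) + 1) ^ 3 ≤ (2 * m) ^ 3 :=
      pow_le_pow_left₀ (by positivity) (by rw [hm']; linarith) 3
    calc (((2 * n + 1) ^ 3 : ℕ) : ℝ) = (2 * (n : ℝ) + 1) ^ 3 := by push_cast; ring
      _ ≤ (2 * m) ^ 3 := h2
      _ = 8 * m ^ 3 := by ring
  calc (((2 * n + 1) ^ 3 : ℕ) : ℝ) * Real.exp (-(c * m ^ ((2 : ℝ) / 3)))
      ≤ 8 * m ^ 3 * (720 / (c ^ 6 * m ^ 4)) := mul_le_mul hpoly hexp (Real.exp_nonneg _) (by positivity)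
    _ = 5760 / c ^ 6 * (1 / m) := by field_simp; ring
    _ = 5760 / c ^ 6 * (1 / ((n : ℝ) + 1)) := by rw [hm']

end JumpFiniteDebris

open JumpFiniteDebris

/-- **S2 (`stub_jumpFiniteDebrisTight`) is implied by crux `PercDebrisSweep.FiniteClusterVolumeTail`
(stmt-CriticalPhenomena-0943), with `M = 0`:** `FiniteClusterVolumeTail →` (`0 < θ(p_c(ℤ³)) → ∀ ε > 0, ∃ M, ∀ᶠ n,
P_{p_c}(M+1 non-percolating points of B(n), each joined inside B(2n) to ∂ⁱⁿB(2n), pairwise unjoined) ≤ ε`).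
A non-percolating point `x ∈ B(n)` joined inside `B(2n)` to `∂ⁱⁿB(2n)` has `n + 1 ≤ |C(x)| < ∞` (almost surely,
on lattice configurations; `succ_le_encard_openCluster`); by translation invariance and the union bound over
`B(n)`, `P ≤ (2n+1)³ · P_{p_c}(n+1 ≤ |C(0)| < ∞) ≤ (2n+1)³ exp(-c (n+1)^{2/3}) → 0`. Bridge only: the
hypothesis is the OPEN crux stmt-CriticalPhenomena-0943; closes nothing by itself. -/
theorem jumpFiniteDebrisTight_of_finiteClusterVolumeTail :
    Summit.CriticalPhenomena.PercolationContinuityZ3.Theses.PercDebrisSweep.FiniteClusterVolumeTail →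
    0 < theta (zdGraph 3) (0 : Site 3) (criticalProbI 3) →
    ∀ ε : ℝ, 0 < ε → ∃ M : ℕ, ∀ᶠ n : ℕ in atTop, (bondPercolation (zdGraph 3) (criticalProbI 3)).real
      {ω | ∃ x : Fin (M + 1) → Site 3, (∀ i, x i ∈ box 3 n) ∧ (∀ i, ω ∉ percolatesAt (x i)) ∧
        (∀ i, ∃ y ∈ innerBoundary (zdGraph 3) (box 3 (2 * n)),
          ω ∈ openConnIn (↑(box 3 (2 * n)) : Set (Site 3)) (x i) y) ∧
        ∀ i j, i ≠ j → ω ∉ openConnIn (↑(box 3 (2 * n)) : Set (Site 3)) (x i) (x j)} ≤ ε := by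
  intro hK hθ ε hε
  obtain ⟨c, hc, hKZ⟩ := hK (criticalProbI 3) hθ
  refine ⟨0, ?_⟩
  -- the volume-tail event at the origin, `{m ≤ |C(0)| < ∞}`
  set E : ℕ → Set (BondConfig (Site 3)) := fun m =>
    {ω | (m : ℕ∞) ≤ (openCluster ω 0).encard ∧ (openCluster ω 0).Finite} with hE
  -- pointwise bound at every scale `n`
  have hbound : ∀ n : ℕ, (bondPercolation (zdGraph 3) (criticalProbI 3)).real
      {ω | ∃ x : Fin (0 + 1) → Site 3, (∀ i, x i ∈ box 3 n) ∧ (∀ i, ω ∉ percolatesAt (x i)) ∧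
        (∀ i, ∃ y ∈ innerBoundary (zdGraph 3) (box 3 (2 * n)),
          ω ∈ openConnIn (↑(box 3 (2 * n)) : Set (Site 3)) (x i) y) ∧
        ∀ i j, i ≠ j → ω ∉ openConnIn (↑(box 3 (2 * n)) : Set (Site 3)) (x i) (x j)} ≤
      (((2 * n + 1) ^ 3 : ℕ) : ℝ) * Real.exp (-(c * ((n + 1 : ℕ) : ℝ) ^ ((2 : ℝ) / 3))) := by
    intro n
    calc (bondPercolation (zdGraph 3) (criticalProbI 3)).real
          {ω | ∃ x : Fin (0 + 1) → Site 3, (∀ i, x i ∈ box 3 n) ∧ (∀ i, ω ∉ percolatesAt (x i)) ∧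
            (∀ i, ∃ y ∈ innerBoundary (zdGraph 3) (box 3 (2 * n)),
              ω ∈ openConnIn (↑(box 3 (2 * n)) : Set (Site 3)) (x i) y) ∧
            ∀ i j, i ≠ j → ω ∉ openConnIn (↑(box 3 (2 * n)) : Set (Site 3)) (x i) (x j)}
        ≤ (bondPercolation (zdGraph 3) (criticalProbI 3)).real (⋃ x ∈ box 3 n,
            BondConfig.relabel (sym2Equiv (Site.shift (-x))) ⁻¹' E (n + 1)) := by
          refine DCT16.real_mono_of_forall_subset_edgeSet (zdGraph 3) (criticalProbI 3) fun ω hω hωD => ?_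
          obtain ⟨x, hxbox, hfin, hspan, -⟩ := hωD
          obtain ⟨y, hy, hconn⟩ := hspan 0
          refine Set.mem_biUnion (Finset.mem_coe.2 (hxbox 0)) ?_
          have hC := openCluster_relabel_shift (-(x 0)) ω (x 0)
          rw [add_neg_cancel] at hC
          simp only [hE, Set.mem_preimage, Set.mem_setOf_eq]
          rw [hC, (add_left_injective (-(x 0))).encard_image,
            Set.finite_image_iff (add_left_injective (-(x 0))).injOn]
          exact ⟨succ_le_encard_openCluster hω (hxbox 0) hy hconn, Set.not_infinite.1 (hfin 0)⟩
      _ ≤ ∑ x ∈ box 3 n, (bondPercolation (zdGraph 3) (criticalProbI 3)).real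
            (BondConfig.relabel (sym2Equiv (Site.shift (-x))) ⁻¹' E (n + 1)) :=
          measureReal_biUnion_finset_le _ _
      _ = ∑ _x ∈ box 3 n, (bondPercolation (zdGraph 3) (criticalProbI 3)).real (E (n + 1)) :=
          Finset.sum_congr rfl fun x _ => bondPercolation_real_preimage_shift (-x) _ _
      _ ≤ ∑ _x ∈ box 3 n, Real.exp (-(c * ((n + 1 : ℕ) : ℝ) ^ ((2 : ℝ) / 3))) :=
          Finset.sum_le_sum fun x _ => hKZ (n + 1) (Nat.le_add_left 1 n)
      _ = (((2 * n + 1) ^ 3 : ℕ) : ℝ) * Real.exp (-(c * ((n + 1 : ℕ) : ℝ) ^ ((2 : ℝ) / 3))) := by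
          rw [Finset.sum_const, nsmul_eq_mul, card_box]
  -- the analytic decay `(2n+1)³ exp(-c (n+1)^{2/3}) ≤ (5760/c⁶)/(n+1) → 0`
  have htend : Tendsto (fun n : ℕ => 5760 / c ^ 6 * (1 / ((n : ℝ) + 1))) atTop (𝓝 0) := by
    have h := (tendsto_one_div_add_atTop_nhds_zero_nat (𝕜 := ℝ)).const_mul (5760 / c ^ 6)
    rw [mul_zero] at h
    exact h
  filter_upwards [(tendsto_order.1 htend).2 ε hε] with n hn
  exact (hbound n).trans ((cube_mul_exp_le hc n).trans hn.le)

end Summit.CriticalPhenomena.PercolationContinuityZ3.Theorems.NonProliferation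

end
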